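import Summits.Ventures.CertifiedManyBodySolver.Rows.HomTorusTTPrimeModel
import HarnessLib

/-!
# `t–t'` Hubbard tori generated by an additive lattice map (Part III: graded locality of the commutator)

HONEST FRAMING: first certified bounds; not a superconductivity verdict; every number certified or
labelled float. INFRASTRUCTURE (continues `HomTorusTTPrimeModel`): for an observable `A` of `Λ`,
embedded into the torus generated by `φ : ℤ² →+ (ℤ/Nℤ)^{d'}` through a window `Λ' ⊇ thicken Λ 1` on
which `φ` is injective (SHARP hypothesis — not on `thicken Λ' 1`),
`[H^{tt'}_φ, Γ A] = Γ([H^{tt'}_{Λ'}, A])` (`homHubbardTT'_commutator_fermionEmbed`): the diagonal hopping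
Hamiltonian `homHubbard (φ ∘ D) t' 0` is the embedded local Hamiltonian of the diagonal interaction plus
far terms plus wrap-around diagonal bonds (`homDiagHamiltonian_eq_fermionEmbed_localHamiltonian_add_wrap`),
both even and supported away from the image of `Λ` (Part I), and the nearest-neighbour part is
`HomTorusLocalHamiltonian`. Patterned on the tree's `HubbardNNNHoppingLocalHamiltonian` Part IV and on
`TorusCeilingTTPrimeSharp` (`φ = x ↦ x mod L`). [cite: BratteliRobinsonII1997, Thm. 6.2.4]
[cite: XuEtAl2024, eq. (1)] [cite: Han2020Bootstrap, §3]
-/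

noncomputable section

open Matrix Finset
open Literature.MathematicalPhysics.QuantumLattice
open Literature.MathematicalPhysics.QuantumFieldTheory hiding Site
open Literature.MathematicalPhysics.QuantumManyBody.StateRelaxation
open Literature.Probability.LatticeModels
open HubbardWave0
open scoped ComplexOrder ComplexConjugate

namespace Summit.Ventures.CertifiedManyBodySolver.Rows

section Decomposition

variable {d' N : ℕ} [NeZero N] (φ : Site 2 →+ TorusSite d' N) (t t' U : ℝ)

/-- **`H^{t'}_φ = Γ(H^{t'}_{Λ'}) + far terms + wrap-around diagonal bonds`**: for `x ↦ x mod L` injective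
on `Λ'` (only), the diagonal hopping Hamiltonian of the torus is the embedded free-boundary local
Hamiltonian of the diagonal interaction on `Λ'` plus the hopping terms of the diagonal torus bonds not
inside the image `I'` of `Λ'`, plus the hopping terms of the diagonal torus bonds inside `I'` that are not
images of lattice diagonal bonds (wrap-around bonds; absent when `φ` is injective on
`thicken Λ' 1`, cf. the tree's `diagHamiltonian_eq_fermionEmbed_localHamiltonian_add`).
[cite: BratteliRobinsonII1997, §6.2.1 (H_Λ' = H_Λ + W)] -/
theorem homDiagHamiltonian_eq_fermionEmbed_localHamiltonian_add_wrap {Λ' : Finset (Site 2)}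
    (hInj : Set.InjOn φ ↑Λ') :
    homHubbard (φ.comp diagMap) t' 0 =
      fermionEmbed (homEmb φ hInj) ((diagHoppingFermionInteraction t').localHamiltonian Λ') +
        (-(t' : ℂ) • ∑ a : FermionTorus d' N, ∑ b : FermionTorus d' N,
            (if ¬(a ∈ Λ'.image (fun x => FermionTorus.ofTorusSite (φ x)) ∧
                b ∈ Λ'.image (fun x => FermionTorus.ofTorusSite (φ x))) then
              ∑ σ : Fin 2, (if (homTorusGraph (φ.comp diagMap)).Adj a b then creation (orb a σ) * annihilation (orb b σ) else 0)
            else 0) +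
          -(t' : ℂ) • ∑ x ∈ Λ', ∑ y ∈ Λ',
            (if (homTorusGraph (φ.comp diagMap)).Adj (FermionTorus.ofTorusSite (φ x))
                  (FermionTorus.ofTorusSite (φ y)) ∧
                  ¬((∃ s : Fin 2, y = x + diagVec s) ∨ ∃ s : Fin 2, x = y + diagVec s) then
              ∑ σ : Fin 2, creation (orb (FermionTorus.ofTorusSite (φ x)) σ) *
                annihilation (orb (FermionTorus.ofTorusSite (φ y)) σ)
            else 0)) := by
  have hι : Set.InjOn (fun x : Site 2 => FermionTorus.ofTorusSite (φ x)) ↑Λ' :=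
    injOn_ofTorusSite_hom φ hInj
  rw [fermionEmbed_homEmb_diag_localHamiltonian, homHubbard, hamiltonian, Complex.ofReal_zero, zero_smul, add_zero]
  -- split each term according to whether the bond lies in the image of `Λ'`
  have hsplit : ∀ a b : FermionTorus d' N,
      (∑ σ : Fin 2, (if (homTorusGraph (φ.comp diagMap)).Adj a b then creation (orb a σ) * annihilation (orb b σ) else 0)) =
        (if a ∈ Λ'.image (fun x => FermionTorus.ofTorusSite (φ x)) ∧
            b ∈ Λ'.image (fun x => FermionTorus.ofTorusSite (φ x)) then
          ∑ σ : Fin 2, (if (homTorusGraph (φ.comp diagMap)).Adj a b then creation (orb a σ) * annihilation (orb b σ) else 0)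
          else 0) +
        (if ¬(a ∈ Λ'.image (fun x => FermionTorus.ofTorusSite (φ x)) ∧
            b ∈ Λ'.image (fun x => FermionTorus.ofTorusSite (φ x))) then
          ∑ σ : Fin 2, (if (homTorusGraph (φ.comp diagMap)).Adj a b then creation (orb a σ) * annihilation (orb b σ) else 0)
          else 0) := by
    intro a b
    by_cases hab : a ∈ Λ'.image (fun x => FermionTorus.ofTorusSite (φ x)) ∧
        b ∈ Λ'.image (fun x => FermionTorus.ofTorusSite (φ x))
    · rw [if_pos hab, if_neg (not_not.2 hab), add_zero]
    · rw [if_neg hab, if_pos hab, zero_add]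
  -- a diagonal bond term between image sites is the image of a lattice diagonal bond term or a wrap-around term
  have hterm : ∀ x ∈ Λ', ∀ y ∈ Λ',
      (∑ σ : Fin 2, (if (homTorusGraph (φ.comp diagMap)).Adj (FermionTorus.ofTorusSite (φ x))
          (FermionTorus.ofTorusSite (φ y)) then
        creation (orb (FermionTorus.ofTorusSite (φ x)) σ) *
          annihilation (orb (FermionTorus.ofTorusSite (φ y)) σ) else 0)) =
        (if ((∃ s : Fin 2, y = x + diagVec s) ∨ ∃ s : Fin 2, x = y + diagVec s) then
            ∑ σ : Fin 2, creation (orb (FermionTorus.ofTorusSite (φ x)) σ) *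
              annihilation (orb (FermionTorus.ofTorusSite (φ y)) σ) else 0) +
          (if (homTorusGraph (φ.comp diagMap)).Adj (FermionTorus.ofTorusSite (φ x))
                (FermionTorus.ofTorusSite (φ y)) ∧
                ¬((∃ s : Fin 2, y = x + diagVec s) ∨ ∃ s : Fin 2, x = y + diagVec s) then
            ∑ σ : Fin 2, creation (orb (FermionTorus.ofTorusSite (φ x)) σ) *
              annihilation (orb (FermionTorus.ofTorusSite (φ y)) σ) else 0) := by
    intro x hx y hy
    by_cases hxy : (∃ s : Fin 2, y = x + diagVec s) ∨ ∃ s : Fin 2, x = y + diagVec s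
    · have hadj := homTorusDiag_adj_of_diagAdj φ hInj hx hy hxy
      rw [if_pos hxy, if_neg (fun h => h.2 hxy), add_zero]
      exact Finset.sum_congr rfl fun σ _ => if_pos hadj
    · rw [if_neg hxy, zero_add]
      by_cases hadj : (homTorusGraph (φ.comp diagMap)).Adj (FermionTorus.ofTorusSite (φ x))
          (FermionTorus.ofTorusSite (φ y))
      · rw [if_pos ⟨hadj, hxy⟩]
        exact Finset.sum_congr rfl fun σ _ => if_pos hadj
      · rw [if_neg (fun h => hadj h.1)]
        exact Finset.sum_eq_zero fun σ _ => if_neg hadj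
  -- the bonds inside the image
  have hin : ∑ a : FermionTorus d' N, ∑ b : FermionTorus d' N,
      (if a ∈ Λ'.image (fun x => FermionTorus.ofTorusSite (φ x)) ∧
          b ∈ Λ'.image (fun x => FermionTorus.ofTorusSite (φ x)) then
        ∑ σ : Fin 2, (if (homTorusGraph (φ.comp diagMap)).Adj a b then creation (orb a σ) * annihilation (orb b σ) else 0)
        else 0) =
      ∑ x ∈ Λ', ∑ y ∈ Λ', (if ((∃ s : Fin 2, y = x + diagVec s) ∨ ∃ s : Fin 2, x = y + diagVec s) then
          ∑ σ : Fin 2, creation (orb (FermionTorus.ofTorusSite (φ x)) σ) *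
            annihilation (orb (FermionTorus.ofTorusSite (φ y)) σ) else 0) +
        ∑ x ∈ Λ', ∑ y ∈ Λ',
          (if (homTorusGraph (φ.comp diagMap)).Adj (FermionTorus.ofTorusSite (φ x))
                (FermionTorus.ofTorusSite (φ y)) ∧
                ¬((∃ s : Fin 2, y = x + diagVec s) ∨ ∃ s : Fin 2, x = y + diagVec s) then
            ∑ σ : Fin 2, creation (orb (FermionTorus.ofTorusSite (φ x)) σ) *
              annihilation (orb (FermionTorus.ofTorusSite (φ y)) σ) else 0) := by
    calc ∑ a : FermionTorus d' N, ∑ b : FermionTorus d' N,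
          (if a ∈ Λ'.image (fun x => FermionTorus.ofTorusSite (φ x)) ∧
              b ∈ Λ'.image (fun x => FermionTorus.ofTorusSite (φ x)) then
            ∑ σ : Fin 2, (if (homTorusGraph (φ.comp diagMap)).Adj a b then creation (orb a σ) * annihilation (orb b σ) else 0)
            else 0)
        = ∑ a : FermionTorus d' N, (if a ∈ Λ'.image (fun x => FermionTorus.ofTorusSite (φ x)) then
            ∑ b ∈ Λ'.image (fun x => FermionTorus.ofTorusSite (φ x)),
              ∑ σ : Fin 2, (if (homTorusGraph (φ.comp diagMap)).Adj a b then creation (orb a σ) * annihilation (orb b σ) else 0)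
            else 0) := by
          refine Finset.sum_congr rfl fun a _ => ?_
          by_cases ha : a ∈ Λ'.image (fun x => FermionTorus.ofTorusSite (φ x))
          · simp only [ha, true_and, if_true]
            rw [Finset.sum_ite_mem, Finset.univ_inter]
          · simp only [ha, false_and, if_false, Finset.sum_const_zero]
      _ = ∑ a ∈ Λ'.image (fun x => FermionTorus.ofTorusSite (φ x)),
            ∑ b ∈ Λ'.image (fun x => FermionTorus.ofTorusSite (φ x)),
              ∑ σ : Fin 2, (if (homTorusGraph (φ.comp diagMap)).Adj a b then creation (orb a σ) * annihilation (orb b σ) else 0) := by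
          rw [Finset.sum_ite_mem, Finset.univ_inter]
      _ = ∑ x ∈ Λ', ∑ y ∈ Λ', ∑ σ : Fin 2,
            (if (homTorusGraph (φ.comp diagMap)).Adj (FermionTorus.ofTorusSite (φ x))
                (FermionTorus.ofTorusSite (φ y)) then
              creation (orb (FermionTorus.ofTorusSite (φ x)) σ) *
                annihilation (orb (FermionTorus.ofTorusSite (φ y)) σ) else 0) := by
          rw [Finset.sum_image hι]
          exact Finset.sum_congr rfl fun x _ => Finset.sum_image hι
      _ = _ := by
          rw [← Finset.sum_add_distrib]
          refine Finset.sum_congr rfl fun x hx => ?_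
          rw [← Finset.sum_add_distrib]
          exact Finset.sum_congr rfl fun y hy => hterm x hx y hy
  have hhop : ∑ a : FermionTorus d' N, ∑ b : FermionTorus d' N, ∑ σ : Fin 2,
        (if (homTorusGraph (φ.comp diagMap)).Adj a b then creation (orb a σ) * annihilation (orb b σ) else 0) =
      (∑ x ∈ Λ', ∑ y ∈ Λ', (if ((∃ s : Fin 2, y = x + diagVec s) ∨ ∃ s : Fin 2, x = y + diagVec s) then
          ∑ σ : Fin 2, creation (orb (FermionTorus.ofTorusSite (φ x)) σ) *
            annihilation (orb (FermionTorus.ofTorusSite (φ y)) σ) else 0) +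
        ∑ x ∈ Λ', ∑ y ∈ Λ',
          (if (homTorusGraph (φ.comp diagMap)).Adj (FermionTorus.ofTorusSite (φ x))
                (FermionTorus.ofTorusSite (φ y)) ∧
                ¬((∃ s : Fin 2, y = x + diagVec s) ∨ ∃ s : Fin 2, x = y + diagVec s) then
            ∑ σ : Fin 2, creation (orb (FermionTorus.ofTorusSite (φ x)) σ) *
              annihilation (orb (FermionTorus.ofTorusSite (φ y)) σ) else 0)) +
        ∑ a : FermionTorus d' N, ∑ b : FermionTorus d' N,
            (if ¬(a ∈ Λ'.image (fun x => FermionTorus.ofTorusSite (φ x)) ∧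
                b ∈ Λ'.image (fun x => FermionTorus.ofTorusSite (φ x))) then
              ∑ σ : Fin 2, (if (homTorusGraph (φ.comp diagMap)).Adj a b then creation (orb a σ) * annihilation (orb b σ) else 0)
            else 0) := by
    rw [← hin, ← Finset.sum_add_distrib]
    refine Finset.sum_congr rfl fun a _ => ?_
    rw [← Finset.sum_add_distrib]
    exact Finset.sum_congr rfl fun b _ => hsplit a b
  rw [hhop, smul_add, smul_add]
  abel

/-- **`H^{t'}_φ - Γ(H^{t'}_{Λ'})` is even and far from `Λ`** under the sharp hypothesis: for `Λ ⊆ Λ'`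
with all four diagonal neighbours of every site of `Λ` in `Λ'` and `φ` injective on `Λ'`, the
difference of the diagonal hopping Hamiltonian of the torus and the embedded local Hamiltonian of the
diagonal interaction on `Λ'` lies in the even CAR subalgebra of the orbitals away from the image of `Λ`
(far terms by the tree lemma `far_diag_hopping_mem_carEvenSubalgebra`; wrap-around diagonal bonds by
`wrapDiag_hopping_mem_carEvenSubalgebra`). [cite: BratteliRobinsonII1997, §6.2.1 and §5.2.2] -/
theorem homDiagHamiltonian_sub_fermionEmbed_localHamiltonian_mem_carEvenSubalgebra
    {Λ Λ' : Finset (Site 2)} (hΛ : Λ ⊆ Λ')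
    (hclosedD : ∀ x ∈ Λ, ∀ s : Fin 2, x + diagVec s ∈ Λ' ∧ x - diagVec s ∈ Λ')
    (hInj : Set.InjOn φ ↑Λ') :
    homHubbard (φ.comp diagMap) t' 0 -
        fermionEmbed (homEmb φ hInj) ((diagHoppingFermionInteraction t').localHamiltonian Λ') ∈
      carEvenSubalgebra (orbs (Λ.image fun x => FermionTorus.ofTorusSite (φ x)))ᶜ := by
  rw [homDiagHamiltonian_eq_fermionEmbed_localHamiltonian_add_wrap φ t' hInj, add_sub_cancel_left]
  exact add_mem (SMulMemClass.smul_mem _ (far_diag_hopping_mem_carEvenSubalgebra_hom φ hΛ hclosedD))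
    (SMulMemClass.smul_mem _ (wrapDiag_hopping_mem_carEvenSubalgebra_hom φ hΛ hclosedD hInj))

/-- **`H^{tt'}_φ - Γ(H^{tt'}_{Λ'})` is even and far from `Λ`** under the sharp hypothesis: if `Λ ⊆ Λ'`,
all eight king-move neighbours of every site of `Λ` lie in `Λ'` (`thicken Λ 1 ⊆ Λ'`) and `φ`
is injective on `Λ'` (NOT necessarily on `thicken Λ' 1`), then the difference of the `t–t'` torus
Hamiltonian `homHubbardTT' φ t t' U` and the embedded local Hamiltonian of the `t–t'` interaction on
`Λ'` belongs to the even CAR subalgebra of the orbitals over the complement of the image of `Λ`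
(nearest-neighbour part: pub-mbboot's `hubbardTorus_sub_fermionEmbed_localHamiltonian_mem_carEvenSubalgebra_sharp`;
diagonal part: `diagHamiltonian_sub_fermionEmbed_localHamiltonian_mem_carEvenSubalgebra_sharp`).
[cite: BratteliRobinsonII1997, §6.2.1 and §5.2.2] -/
theorem homHubbardTT'_sub_fermionEmbed_localHamiltonian_mem_carEvenSubalgebra
    {Λ Λ' : Finset (Site 2)} (hΛ : Λ ⊆ Λ') (h8 : thicken Λ 1 ⊆ Λ')
    (hInj : Set.InjOn φ ↑Λ') :
    homHubbardTT' φ t t' U -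
        fermionEmbed (homEmb φ hInj) ((hubbardTTPrimeFermionInteraction t t' U).localHamiltonian Λ') ∈
      carEvenSubalgebra (orbs (Λ.image fun x => FermionTorus.ofTorusSite (φ x)))ᶜ := by
  obtain ⟨hclosed, hclosedD⟩ := neighbours_mem_of_thicken_subset h8
  rw [hubbardTTPrimeFermionInteraction_localHamiltonian, fermionEmbed_add, homHubbardTT']
  have e : homHubbard φ t U + homHubbard (φ.comp diagMap) t' 0 -
      (fermionEmbed (homEmb φ hInj) ((hubbardFermionInteraction 2 t U).localHamiltonian Λ') +
        fermionEmbed (homEmb φ hInj) ((diagHoppingFermionInteraction t').localHamiltonian Λ')) =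
      (homHubbard φ t U -
          fermionEmbed (homEmb φ hInj) ((hubbardFermionInteraction 2 t U).localHamiltonian Λ')) +
        (homHubbard (φ.comp diagMap) t' 0 -
          fermionEmbed (homEmb φ hInj) ((diagHoppingFermionInteraction t').localHamiltonian Λ')) := by
    abel
  rw [e]
  exact add_mem (homHubbard_sub_fermionEmbed_localHamiltonian_mem_carEvenSubalgebra φ t U hΛ hclosed hInj)
    (homDiagHamiltonian_sub_fermionEmbed_localHamiltonian_mem_carEvenSubalgebra φ t' hΛ hclosedD hInj)

/-- **Graded locality on the torus** (sharp hypothesis): `H^{tt'}_φ - Γ(H^{tt'}_{Λ'})` commutes with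
every embedded observable of `Λ`. [cite: BratteliRobinsonII1997, §5.2.2] -/
theorem commute_homHubbardTT'_sub_fermionEmbed_localHamiltonian {Λ Λ' : Finset (Site 2)}
    (hΛ : Λ ⊆ Λ') (h8 : thicken Λ 1 ⊆ Λ')
    (hInj : Set.InjOn φ ↑Λ') (A : FermionOp Λ) :
    Commute (homHubbardTT' φ t t' U -
        fermionEmbed (homEmb φ hInj) ((hubbardTTPrimeFermionInteraction t t' U).localHamiltonian Λ'))
      (fermionEmbed (homEmb φ hInj) (fermionEmbed (PolySite.incl hΛ) A)) := by
  rw [fermionEmbed_fermionEmbed]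
  refine commute_of_mem_carEvenSubalgebra
    (homHubbardTT'_sub_fermionEmbed_localHamiltonian_mem_carEvenSubalgebra φ t t' U hΛ h8 hInj)
    (fermionEmbed_mem_carSubalgebra _ A) ?_
  exact disjoint_compl_left_iff.2 (orbs_map_incl_trans_homEmb_subset φ hΛ _)

/-- **The commutator with the `t–t'` torus Hamiltonian is the embedded local commutator — sharp torus
hypothesis.** For an observable `A` of `Λ`, embedded into the torus through `Λ' ⊇ thicken Λ 1`
(`φ` injective on `Λ'` — NOT necessarily on `thicken Λ' 1`),
`[H^{tt'}_φ, Γ A] = Γ([H^{tt'}_{Λ'}, A])`; the tree's `hubbardTorusTT'_commutator_fermionEmbed` is the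
special case of an injectivity hypothesis on `thicken Λ' 1` (for a window of coordinate spread `M`:
`L ≥ M + 1` here versus `L ≥ M + 3` there). Bratteli–Robinson II Thm. 6.2.4 on the torus, `t–t'` model
of Xu et al. (2024) eq. (1). [cite: BratteliRobinsonII1997, Thm. 6.2.4] -/
theorem homHubbardTT'_commutator_fermionEmbed {Λ Λ' : Finset (Site 2)}
    (hΛ : Λ ⊆ Λ') (h8 : thicken Λ 1 ⊆ Λ')
    (hInj : Set.InjOn φ ↑Λ') (A : FermionOp Λ) :
    homHubbardTT' φ t t' U * fermionEmbed (homEmb φ hInj) (fermionEmbed (PolySite.incl hΛ) A) -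
        fermionEmbed (homEmb φ hInj) (fermionEmbed (PolySite.incl hΛ) A) * homHubbardTT' φ t t' U =
      fermionEmbed (homEmb φ hInj)
        ((hubbardTTPrimeFermionInteraction t t' U).localHamiltonian Λ' * fermionEmbed (PolySite.incl hΛ) A -
          fermionEmbed (PolySite.incl hΛ) A * (hubbardTTPrimeFermionInteraction t t' U).localHamiltonian Λ') := by
  have hc := commute_homHubbardTT'_sub_fermionEmbed_localHamiltonian φ t t' U hΛ h8 hInj A
  rw [Commute, SemiconjBy, sub_mul, mul_sub, sub_eq_sub_iff_sub_eq_sub] at hc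
  rw [fermionEmbed_sub, fermionEmbed_mul, fermionEmbed_mul]
  exact hc

end Decomposition

end Summit.Ventures.CertifiedManyBodySolver.Rows

end
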